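import Literature.NumberTheory.Automorphic.Liu2021.Def411IrreducibleOfLemD1AsPrinted
import Literature.RepresentationTheory.MoeglinVignerasWaldspurger1987.RankOneThetaLift
import Literature.NumberTheory.Automorphic.Liu2021.LemD1DataOfPlaceIsometric
import HarnessLib

/-!
# [Liu2021, Lem. D.1, first sentence + (1)] AT A FINITE PLACE, `n ≥ 3`, FROM THE LOCAL THETA FACTS — the junction (T) → (D) and
# the composition over the five interface statements as hypotheses

Topic `NumberTheory/Automorphic/Liu2021`; namespaces `Literature.NumberTheory.Automorphic.Liu2021.LemD1OfPlace` (the local model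
`E_v = E ⊗_F F_v`, the datum `LemD1OfPlace.data`) and `Literature.NumberTheory.Automorphic.Liu2021.Def411WeilCarriers` (the as-printed datum
`localLemD1Data … v`).  KERNEL ONLY: theorems, no definition, no named fact, no `sorry`.  Nothing of [Liu2021] or
[MoeglinVignerasWaldspurger1987] is asserted: the three rank-one theta facts of
`Literature/RepresentationTheory/MoeglinVignerasWaldspurger1987/RankOneThetaLift.lean` (`mvw_IV4_rankOne_irreducibleOrZero`,
`mvw_IV4_rankOne_admissible`, `mvw_IV2_rankOne_nonvanishing_of_isotropic`), the split-place consequences and the isotropy of the local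
hermitian space are HYPOTHESES of the composition.

**What is proved** (cell `hodgecm-mathlib`, fan B line `b4-lemD1-item1-at-v`, B-plan1 skeleton v8 sha16 25f03f497e0e1175 §J + composition,
kernel-checked there; landed here so that importable modules — the fan-A head `HypD1pp_of` of `a4-liuD1pp` and its stub (6)
`PerPlace.LemD1Item1AtV` — can cite it BY NAME):

* §J `LemD1OfPlace.lemD1_1AsPrinted_data_of_theta` — **JUNCTION (T) → (D)**, the converse of the tree's
  `LemD1OfPlace.isIrreducible_rep_of_lemD1_1AsPrinted` ∕ `isAdmissible_rep_…` ∕ `nontrivial_coinv_…` (LemD1DataOfPlace.lean): if the maximal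
  `χ`-quotient `TwistedCoinv.rep χ ω hc` of a representation `ω` of `U(J)(F_v)` along the local centre is irreducible-or-zero, admissible and
  NON-ZERO, and `N ≥ 3`, then [Liu2021, Lem. D.1, first sentence + (1)] holds AS PRINTED (`LemD1_1AsPrinted`, Liu2021/LemD1AsPrinted.lean) for
  the datum `LemD1OfPlace.data … ω μ … χ …` — four transports, each an `iff` already in the tree (centre along `θ : E_v¹ ↠ U(J₁)(F_v)`, group
  along `uEquiv`, the identity of `V` as `coinvEquiv`, `quotRep ↔ TwistedCoinv.rep`); in (1) both sides are `False` (`n = 2` contradicts `N ≥ 3`).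
* §C `Def411WeilCarriers.lemD1_1AsPrinted_localLemD1Data_of` — **COMPOSITION**: `LemD1_1AsPrinted (localLemD1Data … v)` for `n ≥ 3` FROM
  (i) the three MVW rank-one theta statements (hypotheses `hIV4a hIV4b hIV2`, instantiated at the smooth section `s := 𝓢.s v` over `iota`,
  `J₁ := (a)`, `χ := χ_{1,v} = localCharOfCenter … χ₁ v`; `𝓢.omegaLoc v = toRep ∘ 𝓢.s v` by `rfl`) at a NON-SPLIT place,
  (ii) the split-place model consequences (hypothesis `hsplit`, under the UNITARITY hypothesis `hL2 : (𝓢.omegaLoc v).IsL2Isometric (μ'ⁿ)` —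
  without it the split statement is false for the generic telescope, `LemD1DataOfPlaceIsometric.lean` header) at a SPLIT place,
  (iii) isotropy of `(E_vⁿ, J_V ⊗ (a))` (hypothesis `hiso`; PROVED for `n ≥ 3` as `not_isAnisotropic_localLemD1Data`, LemD1IsotropyOfPlace.lean),
  and §J.  The hypothesis list is, binder for binder, the body of the fan-A Prop `Summit.HodgeConjecture.CorCM.Lines.A4LiuD1pp.PerPlace.LemD1Item1AtV`
  (a4-liuD1pp.lean 2ff805ec0320d57a).

HC_CM is proved only modulo the 7 printed citations (`hDel`, `h21`, `hLiu418`, `h411`, `h413`, `hD3`, `hD1''`) until rung 0 closes; this file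
discharges none of them and no interface fact.

## References
* [Liu2021] Y. Liu, Camb. J. Math. 9 (2021) = arXiv:2102.11518, App. D Lemma D.1, first sentence + (1) (l. 5226–5229), proof l. 5249–5266
  (split case l. 5253: «identify U(V) with GL_n(F) … unitary induction from P_{n−1,1}»).
* [MoeglinVignerasWaldspurger1987] C. Mœglin, M.-F. Vignéras, J.-L. Waldspurger, LNM 1291, Chap. 3 IV.2 (stable range), IV.4 Thm principal 1a), 2a).
* [GelbartRogawski1990] S. Gelbart, J. Rogawski, §2.6 (the split-place model).
* [Zelevinsky1980] A. Zelevinsky, Ann. Sci. ÉNS 13, Thm 4.2.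
-/

set_option autoImplicit false

noncomputable section

open scoped Matrix Kronecker TensorProduct Classical RestrictedProduct
open NumberField NumberField.mixedEmbedding IsDedekindDomain Filter Set
open Literature.NumberTheory.Automorphic Literature.NumberTheory.Automorphic.UnitaryGroup
open Literature.NumberTheory.Weil1964 Literature.RepresentationTheory
open Literature.RepresentationTheory.HeisenbergGroup
open Literature.GroupTheory.RestrictedProductCharacter
open Literature.NumberTheory Literature.NumberTheory.GelbartRogawski1991 Literature.NumberTheory.GelbartRogawski1991.UnitaryDualPair
open Literature.NumberTheory.GelbartRogawski1991.UnitaryDualPair.WeilCoinv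
open Literature.NumberTheory.Automorphic.Liu2021 Literature.NumberTheory.Automorphic.Liu2021.Def411WeilCarriers
open Literature.RepresentationTheory.CentralCharacterQuotient (augmentation quotRep)
open Literature.RepresentationTheory.MoeglinVignerasWaldspurger1987
open MeasureTheory

/-! ## §J The junction (T) → (D): from the theta lift `TwistedCoinv.rep χ ω hc` to Lemma D.1 (1) AS PRINTED for the datum -/

namespace Literature.NumberTheory.Automorphic.Liu2021.LemD1OfPlace

variable {F : Type} (E : Type) [Field F] [NumberField F] [Field E] [NumberField E] [Algebra F E]
  [Algebra.IsQuadraticExtension F E] (v : HeightOneSpectrum (𝓞 F))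
  (c : E ≃ₐ[F] E) (N : ℕ) (J : Matrix (Fin N) (Fin N) E)
  {δ : E} (hcδ : c δ = -δ) (hδ : δ ≠ 0) (hN : 2 ≤ N) (hJh : (J.map c)ᵀ = J) (hJdet : J.det ≠ 0)
  (J₁ : Matrix (Fin 1) (Fin 1) E)
  {V : Type} [AddCommGroup V] [Module ℂ V] (ω : Representation ℂ (localPi E c N J v) V)
  (μ : (LocalRing E v)ˣ →* ℂˣ) (hμn : ∀ x, ‖((μ x : ℂˣ) : ℂ)‖ = 1) (hμc : Continuous fun x => ((μ x : ℂˣ) : ℂ))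
  (hμF : ∀ a : (v.adicCompletion F)ˣ,
    μ (Units.map (algebraMap (v.adicCompletion F) (LocalRing E v)).toMonoidHom a) = 1 ↔
      ∃ x : (LocalRing E v)ˣ, (x : LocalRing E v) * conjLocal E c v x =
        algebraMap (v.adicCompletion F) (LocalRing E v) a)
  (χ : localPi E c 1 J₁ v →* ℂˣ) (hχn : ∀ h, ‖((χ h : ℂˣ) : ℂ)‖ = 1) (hχc : Continuous fun h => ((χ h : ℂˣ) : ℂ))
  (hJ₁ : J₁ 0 0 ≠ 0)
  (hc : ∀ (g : localPi E c N J v) (h : localPi E c 1 J₁ v),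
    Commute (ω g) ((show Representation ℂ (localPi E c 1 J₁ v) V from ω.comp (localCenter E c N J J₁ hJ₁ v)) h))

/-- **JUNCTION (T) → (D), PROVED** — the converse of `LemD1OfPlace.isIrreducible_rep_of_lemD1_1AsPrinted`,
`isAdmissible_rep_of_lemD1_1AsPrinted`, `nontrivial_coinv_of_lemD1_1AsPrinted`: if the maximal `χ`-quotient `TwistedCoinv.rep χ ω hc` of
a representation `ω` of `U(J)(F_v)` along the local centre is irreducible-or-zero, admissible and NON-ZERO, and `N ≥ 3`, then
[Liu2021, App. D Lemma D.1, first sentence + (1)] holds AS PRINTED for the datum `LemD1OfPlace.data … ω μ … χ …` (in (1) both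
sides are `False`: the space is non-zero, and `n = 2` contradicts `N ≥ 3`).  Four transports, each an `iff` already in the tree:
the acting centre along `θ : E_v¹ ↠ U(J₁)(F_v)`, the group along `uEquiv : S.U ≃ₜ* localPi`, the identity of `V` as `mapEquiv`
(`coinvEquiv`), and `quotRep ↔ TwistedCoinv.rep` for the datum's own pair.
[cite: Liu2021, App. D Lemma D.1 (1) (l. 5226–5229), arXiv:2102.11518 chunk p0056 L21–L23] -/
theorem lemD1_1AsPrinted_data_of_theta (h3 : 3 ≤ N)
    (hirr : IsIrreducibleOrZero (TwistedCoinv.rep χ ω hc)) (hadm : (TwistedCoinv.rep χ ω hc).IsAdmissible)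
    (hnt : Nontrivial (TwistedCoinv.Coinv
      (show Representation ℂ (localPi E c 1 J₁ v) V from ω.comp (localCenter E c N J J₁ hJ₁ v)) χ)) :
    LemD1_1AsPrinted (data E v c N J hcδ hδ hN hJh hJdet J₁ ω μ hμn hμc hμF χ hχn hχc) := by
  -- (3) non-vanishing: centre along `θ`, then `coinvEquiv`, then `quotRep`'s space
  have hB := (nontrivial_coinv_iff_of_comp_surjective_right _ χ (theta E v c N J hcδ hδ hN hJh hJdet J₁)
    (theta_surjective E v c N J hcδ hδ hN hJh hJdet J₁ hJ₁)).2 hnt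
  have hA := (coinvEquiv E v c N J hcδ hδ hN hJh hJdet J₁ ω μ hμn hμc hμF χ hχn hχc hJ₁).toEquiv.nontrivial_congr.2 hB
  have hQ : Nontrivial (V ⧸ augmentation (data E v c N J hcδ hδ hN hJh hJdet J₁ ω μ hμn hμc hμF χ hχn hχc).omega
      (data E v c N J hcδ hδ hN hJh hJdet J₁ ω μ hμn hμc hμF χ hχn hχc).S.scalar
      (data E v c N J hcδ hδ hN hJh hJdet J₁ ω μ hμn hμc hμF χ hχn hχc).chi) :=
    (TwistedCoinv.nontrivial_quotRep_iff _ (standingData E v c N J hcδ hδ hN hJh hJdet).scalar _).2 hA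
  -- (2) admissibility: centre along `θ`, group along `uEquiv`, `coinvEquiv`, `quotRep`
  have hadmC := (isAdmissible_rep_iff_of_comp_surjective_right _ χ
    (theta E v c N J hcδ hδ hN hJh hJdet J₁) (theta_surjective E v c N J hcδ hδ hN hJh hJdet J₁ hJ₁) ω hc
    (commute_theta E v c N J hcδ hδ hN hJh hJdet J₁ ω hJ₁ hc)).2 hadm
  have hadmB := (isAdmissible_rep_comp_iff_of_continuousMulEquiv _ _ ω
      (commute_theta E v c N J hcδ hδ hN hJh hJdet J₁ ω hJ₁ hc) (uEquiv E v c N J hcδ hδ hN hJh hJdet)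
      (commute_uEquiv_theta E v c N J hcδ hδ hN hJh hJdet J₁ ω hJ₁ hc)).2 hadmC
  have hadmA := (Representation.isAdmissible_iff_of_equivariant _ _
      (coinvEquiv E v c N J hcδ hδ hN hJh hJdet J₁ ω μ hμn hμc hμF χ hχn hχc hJ₁)
      (coinvEquiv_rep E v c N J hcδ hδ hN hJh hJdet J₁ ω μ hμn hμc hμF χ hχn hχc hJ₁ hc)).2 hadmB
  have h2 := (TwistedCoinv.isAdmissible_quotRep_iff _ _
    (standingData E v c N J hcδ hδ hN hJh hJdet).scalar_mem_center _
    (commute_scalar E v c N J hcδ hδ hN hJh hJdet J₁ ω μ hμn hμc hμF χ hχn hχc)).2 hadmA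
  -- (1) irreducibility: non-zero ⇒ irreducible, then the same four transports
  haveI := hnt
  have hirrT : (TwistedCoinv.rep χ ω hc).IsIrreducible := isIrreducible_of_nontrivial hirr
  have hirrC := (TwistedCoinv.isIrreducible_rep_iff_of_comp_surjective_right _ χ
    (theta E v c N J hcδ hδ hN hJh hJdet J₁) (theta_surjective E v c N J hcδ hδ hN hJh hJdet J₁ hJ₁) ω hc
    (commute_theta E v c N J hcδ hδ hN hJh hJdet J₁ ω hJ₁ hc)).2 hirrT
  have hirrB := (TwistedCoinv.isIrreducible_rep_comp_iff_of_surjective _ _ ω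
      (commute_theta E v c N J hcδ hδ hN hJh hJdet J₁ ω hJ₁ hc)
      (uEquiv E v c N J hcδ hδ hN hJh hJdet).toMulEquiv.toMonoidHom (uEquiv E v c N J hcδ hδ hN hJh hJdet).surjective
      (commute_uEquiv_theta E v c N J hcδ hδ hN hJh hJdet J₁ ω hJ₁ hc)).2 hirrC
  have hirrA := (TwistedCoinv.isIrreducible_rep_iff_of_mapEquiv _ _ _ _ _ _
      (commute_scalar E v c N J hcδ hδ hN hJh hJdet J₁ ω μ hμn hμc hμF χ hχn hχc)
      (commute_uEquiv_theta E v c N J hcδ hδ hN hJh hJdet J₁ ω hJ₁ hc) (LinearEquiv.refl ℂ V) (fun _ => 1)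
      (acting_pairs_agree E v c N J hcδ hδ hN hJh hJdet J₁ ω μ hμn hμc hμF χ hχn hχc hJ₁)
      (chi_agree E v c N J hcδ hδ hN hJh hJdet J₁ ω μ hμn hμc hμF χ hχn hχc) (MonoidHom.id _)
      Function.surjective_id (fun _ => 1)
      (omega_agree E v c N J hcδ hδ hN hJh hJdet J₁ ω μ hμn hμc hμF χ hχn hχc)).2 hirrB
  have h1 := (TwistedCoinv.isIrreducible_quotRep_iff _ _
    (standingData E v c N J hcδ hδ hN hJh hJdet).scalar_mem_center _
    (commute_scalar E v c N J hcδ hδ hN hJh hJdet J₁ ω μ hμn hμc hμF χ hχn hχc)).2 hirrA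
  -- assembly of the printed conjunction
  refine ⟨⟨isIrreducibleOrZero_of_isIrreducible h1, h2⟩, iff_of_false (not_subsingleton _) ?_⟩
  rintro ⟨-, ⟨-, h2'⟩, -⟩
  omega

end Literature.NumberTheory.Automorphic.Liu2021.LemD1OfPlace

/-! ## §C The composition at the tree's local datum `localLemD1Data … v` -/

namespace Literature.NumberTheory.Automorphic.Liu2021.Def411WeilCarriers

variable (F E : Type) [Field F] [NumberField F] [Field E] [NumberField E] [Algebra F E]
variable (c : E ≃ₐ[F] E) (N : ℕ) {n : ℕ} (e : Fin N × Fin 1 ≃ Fin n)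
variable (JV : Matrix (Fin N) (Fin N) E) {TV : Matrix (Fin N) (Fin N) F}
variable [Algebra.IsQuadraticExtension F E] {δ : E} (hcδ : c δ = -δ) (hδ : δ ≠ 0) {d : F}
  (hd : δ * δ = algebraMap F E d) (hV : TV.IsSymm) (hVd : IsUnit TV.det) (hJV : JV = TV.map (algebraMap F E))
variable (a : Fˣ)
  (𝓢 : LocalSplitting.FinLocalSplittings F E c n hcδ hδ hd (gram F e TV (TW F a)) (isSymm_gram F e hV (isSymm_TW F a))
    (reindex_kronecker_eq_gram_map F E e hJV (JW_eq F E a)))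
  (hn : 3 ≤ n)
  (μ : ∀ v : HeightOneSpectrum (𝓞 F), (LocalRing E v)ˣ →* ℂˣ) (hμn : ∀ v x, ‖((μ v x : ℂˣ) : ℂ)‖ = 1)
  (hμc : ∀ v, Continuous fun x => ((μ v x : ℂˣ) : ℂ))
  (hμF : ∀ (v : HeightOneSpectrum (𝓞 F)) (t : (v.adicCompletion F)ˣ),
    μ v (Units.map (algebraMap (v.adicCompletion F) (LocalRing E v)).toMonoidHom t) = 1 ↔
      ∃ x : (LocalRing E v)ˣ, (x : LocalRing E v) * conjLocal E c v x = algebraMap (v.adicCompletion F) (LocalRing E v) t)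
  (χ₁ : UnitaryGroup.finAdelicOne F E c →* ℂˣ) (hχ₁n : ∀ u, ‖((χ₁ u : ℂˣ) : ℂ)‖ = 1) (hχ₁c : Continuous χ₁)
  (v : HeightOneSpectrum (𝓞 F))

/-- **COMPOSITION: [Liu2021, Lem. D.1, first sentence + (1)] AS PRINTED at the place `v`, `n ≥ 3`**, i.e.
`LemD1_1AsPrinted (localLemD1Data … v)` — the per-place body of the binder `HypD1pp` (hD1'') and the hypothesis `hD1 v` of
`Def411WeilCarriers.rho_isIrreducible_of_lemD1AsPrinted'` (Hyp411) — FROM the five interface statements as hypotheses: the three MVW rank-one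
theta facts `hIV4a : mvw_IV4_rankOne_irreducibleOrZero`, `hIV4b : mvw_IV4_rankOne_admissible`, `hIV2 : mvw_IV2_rankOne_nonvanishing_of_isotropic`
[MoeglinVignerasWaldspurger1987, Chap. 3 IV.4 Thm principal 1a), 2a); IV.2] are INSTANTIATED at a non-split place at the smooth section
`s := 𝓢.s v` over `iota` (`𝓢.proj_s v`, `𝓢.smooth v`), `J₁ := (a)`, `χ := χ_{1,v} = localCharOfCenter … χ₁ v` (unitary, continuous) —
`𝓢.omegaLoc v = toRep ∘ 𝓢.s v` by `rfl` —, the isotropy hypothesis of IV.2 is `hiso` (PROVED for `n ≥ 3`: `not_isAnisotropic_localLemD1Data`),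
the split case is `hsplit` [Liu2021, proof of Lem. D.1 l. 5253; GelbartRogawski1990 §2.6; Zelevinsky1980 Thm 4.2] under the UNITARITY hypothesis
`hL2 : (𝓢.omegaLoc v).IsL2Isometric (μ'ⁿ)` (`μ'` any Haar measure on `F_v`; A-side discharge at `𝓢 = chiLocalSplittingsD …`:
`GRConstruction.isL2Isometric_omegaLoc_congrW_undoubledSplittings_cmFinLocalFamily … v hχu μ'`), and the junction (T) → (D) is
`LemD1OfPlace.lemD1_1AsPrinted_data_of_theta` (§J).  Hypotheses in the order of the fan-A Prop `PerPlace.LemD1Item1AtV` (a4-liuD1pp.lean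
2ff805ec0320d57a), so that `HypD1pp_of := fun … v => lemD1_1AsPrinted_localLemD1Data_of … v mvw_IV4_rankOne_irreducibleOrZero_holds … μ' hL2 …`
at `N = 3`, `𝓢 = OmegaChiSplitting.chiLocalSplittingsD …`.  Proof text = the cell's skeleton `b4-lemD1-item1-at-v` v8 (sha16 25f03f497e0e1175),
composition `HodgecmMathlib.B4.LemD1Item1AtV.lemD1_1AsPrinted_localLemD1Data_of`, verbatim.
[cite: Liu2021, App. D Lemma D.1 (1) (l. 5226–5229), proof l. 5249–5266] [cite: MoeglinVignerasWaldspurger1987, Chap. 3 IV.4 Thm principal 1a), 2a); IV.2] -/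
theorem lemD1_1AsPrinted_localLemD1Data_of
    (hIV4a : mvw_IV4_rankOne_irreducibleOrZero) (hIV4b : mvw_IV4_rankOne_admissible)
    (hIV2 : mvw_IV2_rankOne_nonvanishing_of_isotropic)
    [MeasurableSpace (v.adicCompletion F)] [BorelSpace (v.adicCompletion F)] (μ' : Measure (v.adicCompletion F)) [μ'.IsAddHaarMeasure]
    (hL2 : (𝓢.omegaLoc v).IsL2Isometric (Measure.pi fun _ : Fin n => μ'))
    (hsplit : ¬ IsField (LocalRing E v) → (𝓢.omegaLoc v).IsL2Isometric (Measure.pi fun _ : Fin n => μ') →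
      IsIrreducibleOrZero (TwistedCoinv.rep
        (ρW := show Representation ℂ (localPi E c 1 (JW F E a) v) (SchwartzBruhat (Fin n → v.adicCompletion F)) from
          (𝓢.omegaLoc v).comp (localCenter E c n (Matrix.reindex e e (JV ⊗ₖ JW F E a)) (JW F E a) (JW_apply_ne_zero F E a) v))
        (localCharOfCenter F E c (JW F E a) (JW_apply_ne_zero F E a) χ₁ v) (𝓢.omegaLoc v)
        (fun g z => (show Commute g (localCenter E c n (Matrix.reindex e e (JV ⊗ₖ JW F E a)) (JW F E a) (JW_apply_ne_zero F E a) v z) from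
        localCenter_comm E c n (Matrix.reindex e e (JV ⊗ₖ JW F E a)) (JW F E a) (JW_apply_ne_zero F E a) v z g).map (𝓢.omegaLoc v))) ∧
      (TwistedCoinv.rep
        (ρW := show Representation ℂ (localPi E c 1 (JW F E a) v) (SchwartzBruhat (Fin n → v.adicCompletion F)) from
          (𝓢.omegaLoc v).comp (localCenter E c n (Matrix.reindex e e (JV ⊗ₖ JW F E a)) (JW F E a) (JW_apply_ne_zero F E a) v))
        (localCharOfCenter F E c (JW F E a) (JW_apply_ne_zero F E a) χ₁ v) (𝓢.omegaLoc v)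
        (fun g z => (show Commute g (localCenter E c n (Matrix.reindex e e (JV ⊗ₖ JW F E a)) (JW F E a) (JW_apply_ne_zero F E a) v z) from
        localCenter_comm E c n (Matrix.reindex e e (JV ⊗ₖ JW F E a)) (JW F E a) (JW_apply_ne_zero F E a) v z g).map (𝓢.omegaLoc v))).IsAdmissible ∧
      Nontrivial (TwistedCoinv.Coinv
        (show Representation ℂ (localPi E c 1 (JW F E a) v) (SchwartzBruhat (Fin n → v.adicCompletion F)) from
          (𝓢.omegaLoc v).comp (localCenter E c n (Matrix.reindex e e (JV ⊗ₖ JW F E a)) (JW F E a) (JW_apply_ne_zero F E a) v)) (localCharOfCenter F E c (JW F E a) (JW_apply_ne_zero F E a) χ₁ v)))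
    (hiso : ¬ (localLemD1Data F E c N e JV hcδ hδ hd hV hVd hJV a 𝓢 hn μ hμn hμc hμF χ₁ hχ₁n hχ₁c v).IsAnisotropic) :
    LemD1_1AsPrinted (localLemD1Data F E c N e JV hcδ hδ hd hV hVd hJV a 𝓢 hn μ hμn hμc hμF χ₁ hχ₁n hχ₁c v) := by
  have hT : IsIrreducibleOrZero (TwistedCoinv.rep
        (ρW := show Representation ℂ (localPi E c 1 (JW F E a) v) (SchwartzBruhat (Fin n → v.adicCompletion F)) from
          (𝓢.omegaLoc v).comp (localCenter E c n (Matrix.reindex e e (JV ⊗ₖ JW F E a)) (JW F E a) (JW_apply_ne_zero F E a) v))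
        (localCharOfCenter F E c (JW F E a) (JW_apply_ne_zero F E a) χ₁ v) (𝓢.omegaLoc v)
        (fun g z => (show Commute g (localCenter E c n (Matrix.reindex e e (JV ⊗ₖ JW F E a)) (JW F E a) (JW_apply_ne_zero F E a) v z) from
        localCenter_comm E c n (Matrix.reindex e e (JV ⊗ₖ JW F E a)) (JW F E a) (JW_apply_ne_zero F E a) v z g).map (𝓢.omegaLoc v))) ∧
      (TwistedCoinv.rep
        (ρW := show Representation ℂ (localPi E c 1 (JW F E a) v) (SchwartzBruhat (Fin n → v.adicCompletion F)) from
          (𝓢.omegaLoc v).comp (localCenter E c n (Matrix.reindex e e (JV ⊗ₖ JW F E a)) (JW F E a) (JW_apply_ne_zero F E a) v))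
        (localCharOfCenter F E c (JW F E a) (JW_apply_ne_zero F E a) χ₁ v) (𝓢.omegaLoc v)
        (fun g z => (show Commute g (localCenter E c n (Matrix.reindex e e (JV ⊗ₖ JW F E a)) (JW F E a) (JW_apply_ne_zero F E a) v z) from
        localCenter_comm E c n (Matrix.reindex e e (JV ⊗ₖ JW F E a)) (JW F E a) (JW_apply_ne_zero F E a) v z g).map (𝓢.omegaLoc v))).IsAdmissible ∧
      Nontrivial (TwistedCoinv.Coinv
        (show Representation ℂ (localPi E c 1 (JW F E a) v) (SchwartzBruhat (Fin n → v.adicCompletion F)) from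
          (𝓢.omegaLoc v).comp (localCenter E c n (Matrix.reindex e e (JV ⊗ₖ JW F E a)) (JW F E a) (JW_apply_ne_zero F E a) v)) (localCharOfCenter F E c (JW F E a) (JW_apply_ne_zero F E a) χ₁ v)) := by
    by_cases hf : IsField (LocalRing E v)
    · -- NON-SPLIT: the three MVW facts at the section `𝓢.s v`
      have hiso' : LemD1.IsIsotropic (LemD1OfPlace.standingData E v c n (Matrix.reindex e e (JV ⊗ₖ JW F E a)) hcδ hδ
          (Nat.le_of_succ_le hn) (reindex_kronecker_JW_hermitian F E c N e JV hV hJV a)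
          (det_reindex_kronecker_JW_ne_zero F E N e JV hVd hJV a)) :=
        not_not.mp fun h => hiso ((LemD1Data.isAnisotropic_iff_not_isIsotropic _).mpr h)
      exact ⟨hIV4a F E c n δ hcδ hδ d hd _ _ (isUnit_det_gram F e hVd (isUnit_det_TW F a)) _ _ v hf (𝓢.s v) (𝓢.proj_s v)
          (𝓢.smooth v) (JW F E a) (JW_apply_ne_zero F E a) _
          (norm_localCharOfCenter F E c (JW F E a) (JW_apply_ne_zero F E a) hχ₁n v)
          (continuous_coe_localCharOfCenter F E c (JW F E a) (JW_apply_ne_zero F E a) hχ₁c v),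
        hIV4b F E c n δ hcδ hδ d hd _ _ (isUnit_det_gram F e hVd (isUnit_det_TW F a)) _ _ v hf (𝓢.s v) (𝓢.proj_s v)
          (𝓢.smooth v) (JW F E a) (JW_apply_ne_zero F E a) _
          (norm_localCharOfCenter F E c (JW F E a) (JW_apply_ne_zero F E a) hχ₁n v)
          (continuous_coe_localCharOfCenter F E c (JW F E a) (JW_apply_ne_zero F E a) hχ₁c v),
        hIV2 F E c n δ hcδ hδ d hd _ _ (isUnit_det_gram F e hVd (isUnit_det_TW F a)) _ _ v hf (Nat.le_of_succ_le hn)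
          (reindex_kronecker_JW_hermitian F E c N e JV hV hJV a) (det_reindex_kronecker_JW_ne_zero F E N e JV hVd hJV a) hiso'
          (𝓢.s v) (𝓢.proj_s v) (𝓢.smooth v) (JW F E a) (JW_apply_ne_zero F E a) _
          (norm_localCharOfCenter F E c (JW F E a) (JW_apply_ne_zero F E a) hχ₁n v)
          (continuous_coe_localCharOfCenter F E c (JW F E a) (JW_apply_ne_zero F E a) hχ₁c v)⟩
    · -- SPLIT: the model
      exact hsplit hf hL2
  obtain ⟨h1, h2, h3⟩ := hT
  exact LemD1OfPlace.lemD1_1AsPrinted_data_of_theta E v c n (Matrix.reindex e e (JV ⊗ₖ JW F E a)) hcδ hδ (Nat.le_of_succ_le hn)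
    (reindex_kronecker_JW_hermitian F E c N e JV hV hJV a) (det_reindex_kronecker_JW_ne_zero F E N e JV hVd hJV a) (JW F E a)
    (𝓢.omegaLoc v) (μ v) (hμn v) (hμc v) (hμF v) (localCharOfCenter F E c (JW F E a) (JW_apply_ne_zero F E a) χ₁ v)
    (norm_localCharOfCenter F E c (JW F E a) (JW_apply_ne_zero F E a) hχ₁n v)
    (continuous_coe_localCharOfCenter F E c (JW F E a) (JW_apply_ne_zero F E a) hχ₁c v) (JW_apply_ne_zero F E a)
    (fun g z => (show Commute g (localCenter E c n (Matrix.reindex e e (JV ⊗ₖ JW F E a)) (JW F E a) (JW_apply_ne_zero F E a) v z) from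
        localCenter_comm E c n (Matrix.reindex e e (JV ⊗ₖ JW F E a)) (JW F E a) (JW_apply_ne_zero F E a) v z g).map (𝓢.omegaLoc v))
    hn h1 h2 h3

end Literature.NumberTheory.Automorphic.Liu2021.Def411WeilCarriers

end
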